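import Literature.Computability.Complexity.FoldBricks
import Literature.Computability.Complexity.SplitOnesBricks
import Literature.Computability.MetaComplexity.SchemeEncBricks
import Literature.Computability.MetaComplexity.UniversalHeuristicSchemesProofs
import Literature.Computability.MetaComplexity.UHSParameters
import HarnessLib

/-!
# The search stage of the `2^{O(n / log n)}`-time algorithm (Hirahara's Thm. 6.3 / Cor. 6.4) is in `FP`

Topic `Literature/Computability/MetaComplexity`, machine layer (part 2) of the discharge of
`Hirahara2021_mem_DTIME_of_hasUHS` (`UniversalHeuristicSchemes.lean`; Hirahara, ECCC TR21-058,
Thm. 6.3 / Cor. 6.4). On the **padded input**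

  `P = ⟨1^{2^m} 0 u, x⟩`,  `u = ⟨1ᵏ, ⟨1ᴱ, 1ᴵ⟩⟩`  (`k, E, I, m` of `UHSParameters.lean`, `|u| = m`)

the printed algorithm — "find `i ∈ [I]` such that `C(x; 1^{p_i(n)}; 1ᵏ) = 1` and output
`S(x; 1^{p_i(n)}; 1^{2^k})`" (TR21-058, proof of Thm. 6.3) — is a *polynomial-time* computation in
`|P|`, since `p_i(n) < 2^E ≤ 2^m` and `2^k ≤ 2^m`. This file writes it in the tree's algebra of `FP`
string functions (`BrickAlgebra.lean`: records, `iteFn`, the counted loop `loopStep` /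
`loopFn_mem_FP`), calling the checker and the solver as total one-bit bricks
(`schemeFn`, `SchemeEncBricks.lean`):

* `UHSSearch.body S C p₁` — one round on records `⟨W, ⟨cnt, ⟨1ᵗ, ⟨found, val⟩⟩⟩⟩`,
  `W = ⟨P, 1^{2^k}⟩`: `t := min (p₁ t) |W|` (the cap makes the growth linear on *every* input and
  is inactive on genuine pads), query `C(x; 1ᵗ; 1ᵏ)`, and if it accepts set
  `found := 1, val := S(x; 1ᵗ; 1^{2^k})`; `body_mem_FP`, `length_body_le` (growth), `body_wf`
  (its value on well-formed records);
* `UHSSearch.QFn S C p₁ = finalF ∘ loop ∘ setupF` (`QFn_mem_FP`), with `setupF` computing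
  `1^{2^k}` loop-free as `binToUnaryFn ⟨ruler, ⟦1ᵏ⟧ + 1⟩` and the counter `encodeNat I`;
* **`UHSSearch.QFn_pad`** — on a genuine pad, `QFn S C p₁ P = [L(x)]`, from the machine-independent
  core (`exists_checker_accepts_iterate`, `solver_eq_of_checker_iterate`,
  `UniversalHeuristicSchemesProofs.lean`) and the arithmetic (`UHSParam.lt_I_mul_succ_k`,
  `UHSParam.iterate_lt_two_pow_E`, `UHSParameters.lean`).

## References

* S. Hirahara, *Average-case hardness of NP from exponential worst-case hardness assumptions*,
  STOC 2021; full version ECCC TR21-058: proof of Thm. 6.3 (the algorithm `A`), Cor. 6.4.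
* S. Arora, B. Barak, *Computational Complexity: A Modern Approach*, CUP 2009, §1.3, §1.4.1
  (clocked loops), §2.6.2 (padding).
-/

namespace Literature.Computability.MetaComplexity

open _root_.Computability Complexity Complexity.Brick Complexity.Plumb Polynomial

namespace UHSSearch

variable (S C : List Bool → ℕ → ℕ → Bool) (p₁ : Polynomial ℕ)

/-! ### Reading the pad -/

/-- The parameter word `u` of a pad `P = ⟨1^{M} 0 u, x⟩`. [folklore] -/
noncomputable def uF : List Bool → List Bool := afterZeroFn ∘ fstF

/-- The block `1ᵏ` of a pad. [folklore] -/
noncomputable def kF : List Bool → List Bool := fstF ∘ uF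

/-- The block `1ᴵ` of a pad. [folklore] -/
noncomputable def IF : List Bool → List Bool := sndF ∘ sndF ∘ uF

/-- The block `1^{2^k}` of a pad: the numeral `⟦1ᵏ⟧ + 1 = 2^k` written in unary against the first
component of the pad (which has length `≥ 2^m ≥ 2^k` on genuine pads). [folklore] -/
noncomputable def BkF : List Bool → List Bool :=
  binToUnaryFn ∘ fanoutFn fstF (addFn ∘ fanoutFn kF (fun _ => encodeNat 1))

/-- `uF ∈ FP`. [folklore] -/
theorem uF_mem_FP : uF ∈ FP := comp_mem_FP afterZeroFn_mem_FP fstF_mem_FP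
/-- `kF ∈ FP`. [folklore] -/
theorem kF_mem_FP : kF ∈ FP := comp_mem_FP fstF_mem_FP uF_mem_FP
/-- `IF ∈ FP`. [folklore] -/
theorem IF_mem_FP : IF ∈ FP := comp_mem_FP sndF_mem_FP (comp_mem_FP sndF_mem_FP uF_mem_FP)
/-- `BkF ∈ FP`. [folklore] -/
theorem BkF_mem_FP : BkF ∈ FP :=
  comp_mem_FP binToUnaryFn_mem_FP (fanoutFn_mem_FP fstF_mem_FP
    (comp_mem_FP addFn_mem_FP (fanoutFn_mem_FP kF_mem_FP (const_mem_FP _))))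

section Pad

variable (M kk EE II : ℕ) (x : List Bool)

/-- A pad with first component `1ᴹ 0 ⟨1ᵏ, ⟨1ᴱ, 1ᴵ⟩⟩`. [folklore] -/
def pad : List Bool :=
  boolPair (ones M ++ false :: boolPair (ones kk) (boolPair (ones EE) (ones II))) x

/-- `uF` on a pad. [folklore] -/
@[simp] theorem uF_pad : uF (pad M kk EE II x) = boolPair (ones kk) (boolPair (ones EE) (ones II)) := by
  simp [uF, pad]

/-- `kF` on a pad. [folklore] -/
@[simp] theorem kF_pad : kF (pad M kk EE II x) = ones kk := by simp [kF]

/-- `IF` on a pad. [folklore] -/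
@[simp] theorem IF_pad : IF (pad M kk EE II x) = ones II := by simp [IF]

/-- `fstF`, `sndF` on a pad. [folklore] -/
@[simp] theorem sndF_pad : sndF (pad M kk EE II x) = x := by simp [pad]

/-- Length of the first component of a pad. [folklore] -/
theorem length_fstF_pad :
    (fstF (pad M kk EE II x)).length = M + 1 + (2 * kk + 2 + (2 * EE + 2 + II)) := by
  simp [pad, ones]; ring

/-- `BkF` on a pad with `2^k ≤ M`: the block `1^{2^k}`. [folklore] -/
theorem BkF_pad (hM : 2 ^ kk ≤ M) : BkF (pad M kk EE II x) = ones (2 ^ kk) := by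
  have hval : bitsToNat (ones kk) + 1 = 2 ^ kk := by
    rw [bitsToNat_ones]; have := Nat.one_le_two_pow (n := kk); omega
  simp only [BkF, Function.comp_apply, fanoutFn_apply, kF_pad, addFn_boolPair, bitsToNat_encodeNat,
    hval, binToUnaryFn_boolPair, length_fstF_pad]
  rw [min_eq_left (by omega)]

end Pad

/-! ### One round of the search -/

/-- The capped next iterate `1^{min (p₁ t) |W|}` of a record `⟨W, ⟨cnt, ⟨1ᵗ, _⟩⟩⟩`. [folklore] -/
noncomputable def tF : List Bool → List Bool :=
  takeFn ∘ fanoutFn fstF (polyFn p₁ ∘ fstF ∘ sndPow 1)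

/-- The checker's query `⟨x, ⟨1ᵗ', 1ᵏ⟩⟩` of a record (`x`, `1ᵏ` read off the pad `P = fstF W`).
[folklore] -/
noncomputable def qCF : List Bool → List Bool :=
  fanoutFn (sndF ∘ fstF ∘ fstF) (fanoutFn (tF p₁) (kF ∘ fstF ∘ fstF))

/-- The solver's query `⟨x, ⟨1ᵗ', 1^{2^k}⟩⟩` of a record (`1^{2^k} = sndF W`). [folklore] -/
noncomputable def qSF : List Bool → List Bool :=
  fanoutFn (sndF ∘ fstF ∘ fstF) (fanoutFn (tF p₁) (sndF ∘ fstF))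

/-- **One round** on records `⟨W, ⟨cnt, ⟨1ᵗ, ⟨found, val⟩⟩⟩⟩`: the new state
`⟨1ᵗ', if C(x; 1ᵗ'; 1ᵏ) then ⟨1, S(x; 1ᵗ'; 1^{2^k})⟩ else ⟨found, val⟩⟩`, `t' = min (p₁ t) |W|`.
[Hirahara 2021 (ECCC TR21-058), proof of Thm. 6.3 (the algorithm `A`)] [cite: Hirahara2021, Thm. 6.3 (proof)] -/
noncomputable def body : List Bool → List Bool :=
  fanoutFn (tF p₁)
    (iteFn (schemeFn C ∘ qCF p₁) (fanoutFn (fun _ => [true]) (schemeFn S ∘ qSF p₁))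
      (sndF ∘ sndPow 1))

/-- `tF p₁ ∈ FP`. [folklore] -/
theorem tF_mem_FP : tF p₁ ∈ FP :=
  comp_mem_FP takeFn_mem_FP (fanoutFn_mem_FP fstF_mem_FP
    (comp_mem_FP (polyFn_mem_FP _) (comp_mem_FP fstF_mem_FP (sndPow_mem_FP 1))))

/-- **The round is in `FP`** when the checker and the solver are polynomial-time on the scheme
encoding. [Arora–Barak 2009, §1.3] [folklore] -/
theorem body_mem_FP
    (hS : PolyTimeComputable schemeEnc encodeBool fun q : List Bool × ℕ × ℕ => S q.1 q.2.1 q.2.2)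
    (hC : PolyTimeComputable schemeEnc encodeBool fun q : List Bool × ℕ × ℕ => C q.1 q.2.1 q.2.2) :
    body S C p₁ ∈ FP := by
  have hx : (sndF ∘ fstF ∘ fstF) ∈ FP := comp_mem_FP sndF_mem_FP (comp_mem_FP fstF_mem_FP fstF_mem_FP)
  have hqC : qCF p₁ ∈ FP := fanoutFn_mem_FP hx (fanoutFn_mem_FP (tF_mem_FP p₁)
    (comp_mem_FP kF_mem_FP (comp_mem_FP fstF_mem_FP fstF_mem_FP)))
  have hqS : qSF p₁ ∈ FP :=
    fanoutFn_mem_FP hx (fanoutFn_mem_FP (tF_mem_FP p₁) (comp_mem_FP sndF_mem_FP fstF_mem_FP))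
  exact fanoutFn_mem_FP (tF_mem_FP p₁)
    (iteFn_mem_FP (comp_mem_FP (schemeFn_mem_FP hC) hqC)
      (fanoutFn_mem_FP (const_mem_FP _) (comp_mem_FP (schemeFn_mem_FP hS) hqS))
      (comp_mem_FP sndF_mem_FP (sndPow_mem_FP 1)))

/-- **Growth of one round**, on every input: `|body z| ≤ |sndPow 1 z| + 7 (|fstF z| + 1)` (the
capped iterate has at most `|fstF z|` symbols, the branches at most `5` resp. `|sndPow 1 z|`,
`OracleCompose.length_boolUnpair_snd_le_length`). [folklore] -/
theorem length_body_le (z : List Bool) :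
    (body S C p₁ z).length ≤ (sndPow 1 z).length + 7 * ((fstF z).length + 1) := by
  have ht : (tF p₁ z).length ≤ (fstF z).length := by
    simp only [tF, Function.comp_apply, fanoutFn_apply, takeFn_boolPair]
    exact List.length_take_le _ _
  have hbr : (iteFn (schemeFn C ∘ qCF p₁) (fanoutFn (fun _ => [true]) (schemeFn S ∘ qSF p₁))
      (sndF ∘ sndPow 1) z).length ≤ (sndPow 1 z).length + 5 := by
    rw [iteFn_of_oneBit ((oneBit_schemeFn C).comp _)]
    split_ifs
    · rw [length_fanoutFn]; simp
    · exact (OracleCompose.length_boolUnpair_snd_le_length (sndPow 1 z)).trans (by simp)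
  rw [body, length_fanoutFn]
  omega

/-- `schemeFn` on a query with unary blocks: `schemeFn A ⟨x, ⟨1ᵗ, 1ᵐ⟩⟩ = [A x t m]`. [folklore] -/
theorem schemeFn_boolPair_ones (A : List Bool → ℕ → ℕ → Bool) (x : List Bool) (t m : ℕ) :
    schemeFn A (boolPair x (boolPair (ones t) (ones m))) = [A x t m] := by
  simp [schemeFn, decScheme, ones, encodeBool]

/-- The state word `⟨1ᵗ, ⟨[found], [val]⟩⟩`. [folklore] -/
def stW (t : ℕ) (fb vb : Bool) : List Bool := boolPair (ones t) (boolPair [fb] [vb])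

/-- **Value of one round on a well-formed record** `⟨⟨P, B⟩, ⟨cnt, stW t fb vb⟩⟩` whose pad `P`
carries `x` and `1ᵏ` and whose next iterate is not capped (`p₁ t ≤ |⟨P, B⟩|`).
[Hirahara 2021 (ECCC TR21-058), proof of Thm. 6.3] [cite: Hirahara2021, Thm. 6.3 (proof)] -/
theorem body_wf (M kk EE II : ℕ) (x B cnt : List Bool) (t : ℕ) (fb vb : Bool)
    (ht : p₁.eval t ≤ (boolPair (pad M kk EE II x) B).length) :
    body S C p₁ (boolPair (boolPair (pad M kk EE II x) B) (boolPair cnt (stW t fb vb))) =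
      stW (p₁.eval t) (if C x (p₁.eval t) kk then true else fb)
        (if C x (p₁.eval t) kk then S x (p₁.eval t) B.length else vb) := by
  have htF : tF p₁ (boolPair (boolPair (pad M kk EE II x) B) (boolPair cnt (stW t fb vb))) =
      ones (p₁.eval t) := by
    simp only [tF, Function.comp_apply, fanoutFn_apply, fstF_boolPair, sndPow_succ_boolPair,
      sndPow_zero_boolPair, stW, polyFn_apply, takeFn_boolPair]
    rw [List.take_of_length_le (by simpa [ones] using ht)]
    simp [ones]
  have hqC : (schemeFn C ∘ qCF p₁) (boolPair (boolPair (pad M kk EE II x) B) (boolPair cnt (stW t fb vb))) =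
      [C x (p₁.eval t) kk] := by
    simp only [Function.comp_apply, qCF, fanoutFn_apply, fstF_boolPair, sndF_pad, htF, kF_pad,
      schemeFn_boolPair_ones]
  have hqS : (schemeFn S ∘ qSF p₁) (boolPair (boolPair (pad M kk EE II x) B) (boolPair cnt (stW t fb vb))) =
      [S x (p₁.eval t) B.length] := by
    simp only [Function.comp_apply, qSF, fanoutFn_apply, fstF_boolPair, sndF_boolPair, sndF_pad, htF]
    simp [schemeFn, decScheme, ones, encodeBool]
  rw [body, fanoutFn_apply, htF, iteFn_apply hqC]
  rw [Function.comp_apply] at hqS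
  simp only [stW] at hqS ⊢
  cases C x (p₁.eval t) kk
  · simp
  · simp [fanoutFn_apply, hqS]

/-! ### The mathematical model of the search -/

/-- The state `(t, found, val)` after `i` rounds of the search on `x` with blocks `1ᵏ`, `1^{Bk}`:
`t` runs through the iterates `p_i(n)`, `found` records whether some round accepted, `val` the
solver's answer at the last accepting round. [Hirahara 2021 (ECCC TR21-058), proof of Thm. 6.3]
[cite: Hirahara2021, Thm. 6.3 (proof)] -/
def stAt (x : List Bool) (kk Bk n : ℕ) : ℕ → ℕ × Bool × Bool
  | 0 => (n, false, false)
  | i + 1 =>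
    (p₁.eval (stAt x kk Bk n i).1,
      if C x (p₁.eval (stAt x kk Bk n i).1) kk then true else (stAt x kk Bk n i).2.1,
      if C x (p₁.eval (stAt x kk Bk n i).1) kk then S x (p₁.eval (stAt x kk Bk n i).1) Bk
      else (stAt x kk Bk n i).2.2)

/-- The first component of the state is the iterate `p_i(n)`. [folklore] -/
theorem stAt_fst (x : List Bool) (kk Bk n : ℕ) :
    ∀ i, (stAt S C p₁ x kk Bk n i).1 = (fun m => p₁.eval m)^[i] n
  | 0 => rfl
  | i + 1 => by rw [stAt, Function.iterate_succ_apply', ← stAt_fst x kk Bk n i]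

/-- **Invariant of the search**: if every accepting round `j ≥ 1` makes the solver answer `b`,
then whenever `found` is set, `val = b`; and `found` is set as soon as some round `1 ≤ j ≤ i`
accepted. [Hirahara 2021 (ECCC TR21-058), proof of Thm. 6.3 (correctness of `A`)]
[cite: Hirahara2021, Thm. 6.3 (proof)] -/
theorem stAt_inv (x : List Bool) (kk Bk n : ℕ) (b : Bool)
    (hsol : ∀ j, 1 ≤ j → C x ((fun m => p₁.eval m)^[j] n) kk = true →
      S x ((fun m => p₁.eval m)^[j] n) Bk = b) :
    ∀ i, ((stAt S C p₁ x kk Bk n i).2.1 = true → (stAt S C p₁ x kk Bk n i).2.2 = b) ∧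
      ((∃ j, 1 ≤ j ∧ j ≤ i ∧ C x ((fun m => p₁.eval m)^[j] n) kk = true) →
        (stAt S C p₁ x kk Bk n i).2.1 = true)
  | 0 => ⟨fun h => by simp [stAt] at h, fun ⟨j, h1, h0, _⟩ => by omega⟩
  | i + 1 => by
    obtain ⟨ih1, ih2⟩ := stAt_inv x kk Bk n b hsol i
    have ht : p₁.eval (stAt S C p₁ x kk Bk n i).1 = (fun m => p₁.eval m)^[i + 1] n := by
      rw [stAt_fst, Function.iterate_succ_apply']
    constructor
    · intro hf
      simp only [stAt] at hf ⊢
      by_cases hc : C x (p₁.eval (stAt S C p₁ x kk Bk n i).1) kk = true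
      · rw [if_pos hc]
        rw [ht] at hc ⊢
        exact hsol (i + 1) (by omega) hc
      · rw [if_neg hc] at hf ⊢
        exact ih1 hf
    · rintro ⟨j, hj1, hji, hjC⟩
      simp only [stAt]
      by_cases hc : C x (p₁.eval (stAt S C p₁ x kk Bk n i).1) kk = true
      · rw [if_pos hc]
      · rw [if_neg hc]
        rcases Nat.lt_or_ge j (i + 1) with hlt | hge
        · exact ih2 ⟨j, hj1, by omega, hjC⟩
        · have hj : j = i + 1 := by omega
          subst hj
          rw [ht] at hc
          exact absurd hjC hc

/-- The state word of a state. [folklore] -/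
def enc (s : ℕ × Bool × Bool) : List Bool := stW s.1 s.2.1 s.2.2

/-- **The loop implements the model**: on the record of a pad, as long as the iterates are not
capped, `r` rounds of `body` from the state after `i` rounds give the state after `i + r` rounds.
[Hirahara 2021 (ECCC TR21-058), proof of Thm. 6.3] [cite: Hirahara2021, Thm. 6.3 (proof)] -/
theorem loopModel_body (M kk EE II : ℕ) (x B : List Bool) :
    ∀ (r i : ℕ), (∀ j, j < i + r →
        p₁.eval ((fun m => p₁.eval m)^[j] x.length) ≤ (boolPair (pad M kk EE II x) B).length) →
      loopModel (body S C p₁) (boolPair (pad M kk EE II x) B) r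
          (enc (stAt S C p₁ x kk B.length x.length i)) =
        enc (stAt S C p₁ x kk B.length x.length (i + r))
  | 0, i, _ => rfl
  | r + 1, i, hcap => by
    rw [loopModel]
    have hi : p₁.eval (stAt S C p₁ x kk B.length x.length i).1 ≤ (boolPair (pad M kk EE II x) B).length := by
      rw [stAt_fst]; exact hcap i (by omega)
    have hb := body_wf S C p₁ M kk EE II x B (encodeNat (r + 1)) (stAt S C p₁ x kk B.length x.length i).1
      (stAt S C p₁ x kk B.length x.length i).2.1 (stAt S C p₁ x kk B.length x.length i).2.2 hi
    rw [enc, hb]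
    have he : stW (p₁.eval (stAt S C p₁ x kk B.length x.length i).1)
        (if C x (p₁.eval (stAt S C p₁ x kk B.length x.length i).1) kk then true
          else (stAt S C p₁ x kk B.length x.length i).2.1)
        (if C x (p₁.eval (stAt S C p₁ x kk B.length x.length i).1) kk then
          S x (p₁.eval (stAt S C p₁ x kk B.length x.length i).1) B.length
          else (stAt S C p₁ x kk B.length x.length i).2.2) =
        enc (stAt S C p₁ x kk B.length x.length (i + 1)) := by
      simp only [enc, stAt]
    rw [he, loopModel_body M kk EE II x B r (i + 1) (fun j hj => hcap j (by omega))]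
    rw [Nat.add_right_comm, Nat.add_assoc]

/-! ### The whole stage -/

/-- Setting up the loop record `⟨⟨P, 1^{2^k}⟩, ⟨encodeNat I, ⟨1ⁿ, ⟨[0], [0]⟩⟩⟩⟩` from a pad `P`.
[folklore] -/
noncomputable def setupF : List Bool → List Bool :=
  fanoutFn (fanoutFn id BkF)
    (fanoutFn (lenBinF ∘ IF) (fanoutFn (polyFn X ∘ sndF) (fun _ => boolPair [false] [false])))

/-- The counted loop of the search (`|W|` rounds available, `W` the first field). [folklore] -/
noncomputable def loopF : List Bool → List Bool :=
  fun z => (loopStep (body S C p₁))^[(X : Polynomial ℕ).eval (fstF z).length] z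

/-- Reading the answer off the final record: `val` if `found`, else `0`. [folklore] -/
noncomputable def finalF : List Bool → List Bool :=
  iteFn (fstF ∘ sndF ∘ sndPow 1) (sndF ∘ sndF ∘ sndPow 1) (fun _ => [false])

/-- **The search stage** `QFn = finalF ∘ loopF ∘ setupF`. [Hirahara 2021 (ECCC TR21-058), proof of
Thm. 6.3 (the algorithm `A`)] [cite: Hirahara2021, Thm. 6.3 (proof)] -/
noncomputable def QFn : List Bool → List Bool := finalF ∘ loopF S C p₁ ∘ setupF

/-- `setupF ∈ FP`. [folklore] -/
theorem setupF_mem_FP : setupF ∈ FP :=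
  fanoutFn_mem_FP (fanoutFn_mem_FP OracleCompose.id_mem_FP BkF_mem_FP)
    (fanoutFn_mem_FP (comp_mem_FP lenBinF_mem_FP IF_mem_FP)
      (fanoutFn_mem_FP (comp_mem_FP (polyFn_mem_FP _) sndF_mem_FP) (const_mem_FP _)))

/-- `finalF ∈ FP`. [folklore] -/
theorem finalF_mem_FP : finalF ∈ FP :=
  iteFn_mem_FP (comp_mem_FP fstF_mem_FP (comp_mem_FP sndF_mem_FP (sndPow_mem_FP 1)))
    (comp_mem_FP sndF_mem_FP (comp_mem_FP sndF_mem_FP (sndPow_mem_FP 1))) (const_mem_FP _)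

/-- **The search stage is in `FP`** (counted loop with a body of linear growth, `loopFn_mem_FP`).
[Arora–Barak 2009, §1.3, §1.4.1] [folklore] -/
theorem QFn_mem_FP
    (hS : PolyTimeComputable schemeEnc encodeBool fun q : List Bool × ℕ × ℕ => S q.1 q.2.1 q.2.2)
    (hC : PolyTimeComputable schemeEnc encodeBool fun q : List Bool × ℕ × ℕ => C q.1 q.2.1 q.2.2) :
    QFn S C p₁ ∈ FP :=
  comp_mem_FP finalF_mem_FP (comp_mem_FP
    (loopFn_mem_FP (body_mem_FP S C p₁ hS hC) (length_body_le S C p₁) X) setupF_mem_FP)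

/-- `setupF` on a pad with `2^k ≤ M`. [folklore] -/
theorem setupF_pad (M kk EE II : ℕ) (x : List Bool) (hM : 2 ^ kk ≤ M) :
    setupF (pad M kk EE II x) =
      boolPair (boolPair (pad M kk EE II x) (ones (2 ^ kk)))
        (boolPair (encodeNat II) (enc (x.length, false, false))) := by
  simp [setupF, BkF_pad M kk EE II x hM, enc, stW, ones]

/-- `finalF` on a final record. [folklore] -/
theorem finalF_record (W : List Bool) (t : ℕ) (fb vb : Bool) :
    finalF (boolPair W (boolPair [] (stW t fb vb))) = if fb then [vb] else [false] := by
  have hc : (fstF ∘ sndF ∘ sndPow 1) (boolPair W (boolPair [] (stW t fb vb))) = [fb] := by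
    simp [stW]
  rw [finalF, iteFn_apply hc]
  cases fb <;> simp [stW]

/-- **Correctness of the search stage on a genuine pad** (Hirahara's Thm. 6.3 / Cor. 6.4, the
algorithm `A`): if `(S, C)` satisfy the two items of Def. 6.2 for the polynomial `p₁` with
`p₁(m) ≥ max (m, c₀)` and `p₁(m) + 2 ≤ (m + 2)^{2^d}`, where `K^t(x) ≤ |x| + a₀` for `t ≥ c₀`, then
on the pad `P = ⟨1^{2^m} 0 ⟨1ᵏ, ⟨1ᴱ, 1ᴵ⟩⟩, x⟩` with the parameters of `UHSParameters.lean` the search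
answers `[L(x)]`. (Some round `1 ≤ i ≤ I` accepts by `exists_checker_accepts_iterate` and
`UHSParam.lt_I_mul_succ_k`; every accepting round answers `L(x)` by
`solver_eq_of_checker_iterate`; the caps are inactive by `UHSParam.iterate_lt_two_pow_E`.)
[Hirahara 2021 (ECCC TR21-058), proof of Thm. 6.3 and Cor. 6.4] [cite: Hirahara2021, Thm. 6.3 (proof)] -/
theorem QFn_pad {U : UniversalMachine} {L : Language Bool} {d a₀ c₀ : ℕ}
    (h₁ : ∀ (x : List Bool) (t k : ℕ), p₁.eval x.length ≤ t →
      U.cdAt t (p₁.eval t) x ≤ k → C x t k = true)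
    (h₂ : ∀ (x : List Bool) (t k : ℕ), p₁.eval x.length ≤ t →
      C x t k = true → S x t (2 ^ k) = L.boolIndicator x)
    (hp : ∀ m, m ≤ p₁.eval m)
    (hK : ∀ (x : List Bool) (t : ℕ), c₀ ≤ t → U.ktAt t x ≤ x.length + a₀)
    (hc₀ : ∀ m, c₀ ≤ p₁.eval m) (hd : ∀ m, p₁.eval m + 2 ≤ (m + 2) ^ (2 ^ d)) (x : List Bool) :
    QFn S C p₁ (pad (2 ^ UHSParam.m d a₀ x.length) (UHSParam.k d a₀ x.length)
        (UHSParam.E d x.length) (UHSParam.I d x.length) x) = [L.boolIndicator x] := by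
  set n := x.length with hn
  set kk := UHSParam.k d a₀ n with hkk
  set EE := UHSParam.E d n with hEE
  set II := UHSParam.I d n with hII
  set M := 2 ^ UHSParam.m d a₀ n with hM
  have hkM : 2 ^ kk ≤ M := Nat.pow_le_pow_right two_pos (UHSParam.k_le_m d a₀ n)
  have hEM : 2 ^ EE ≤ M := Nat.pow_le_pow_right two_pos (UHSParam.E_le_m d a₀ n)
  set P := pad M kk EE II x with hP
  set W := boolPair P (ones (2 ^ kk)) with hW
  -- lengths
  have hPW : M ≤ W.length := by
    rw [hW, length_boolPair]
    have : M ≤ P.length := by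
      have h1 := length_fstF_pad M kk EE II x
      have h2 := length_fstF_sndF_le P
      rw [← hP] at h1; omega
    omega
  have hIW : II ≤ W.length := by
    have : II ≤ UHSParam.m d a₀ n := by unfold UHSParam.m; omega
    exact this.trans ((Nat.lt_two_pow_self).le.trans hPW)
  -- the caps are inactive
  have hcap : ∀ j, j < 0 + II → p₁.eval ((fun m => p₁.eval m)^[j] n) ≤ W.length := by
    intro j hj
    have := UHSParam.iterate_lt_two_pow_E hd n (i := j + 1) (by omega)
    rw [Function.iterate_succ_apply'] at this
    exact (this.le.trans hEM).trans hPW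
  -- run the three stages
  rw [QFn, Function.comp_apply, Function.comp_apply, setupF_pad M kk EE II x hkM, loopF]
  rw [fstF_boolPair, eval_X, ← hW, iterate_loopStep _ W II W.length _ hIW]
  have hmodel := loopModel_body S C p₁ M kk EE II x (ones (2 ^ kk)) II 0 hcap
  simp only [Nat.zero_add, ones, List.length_replicate] at hmodel
  rw [← hP, ← hW] at hmodel
  rw [show enc (x.length, false, false) = enc (stAt S C p₁ x kk (2 ^ kk) n 0) from rfl, hmodel, enc,
    finalF_record]
  -- correctness of the final state
  have hsol : ∀ j, 1 ≤ j → C x ((fun m => p₁.eval m)^[j] n) kk = true →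
      S x ((fun m => p₁.eval m)^[j] n) (2 ^ kk) = L.boolIndicator x :=
    fun j hj hC => solver_eq_of_checker_iterate h₂ hp x hj hC
  obtain ⟨hinv1, hinv2⟩ := stAt_inv S C p₁ x kk (2 ^ kk) n (L.boolIndicator x) hsol II
  obtain ⟨i, hi1, hiI, hiC⟩ :=
    exists_checker_accepts_iterate h₁ hp hK hc₀ x (UHSParam.lt_I_mul_succ_k d a₀ n)
  have hfound := hinv2 ⟨i, hi1, hiI, hiC⟩
  rw [hfound, if_pos rfl, hinv1 hfound]

end UHSSearch

end Literature.Computability.MetaComplexity
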